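import Summits.Ventures.PackingBounds.ThreePointCert.K7d12Agg1

/-!
# κ(7) ≤ 134: kernel validation of Gram block R0 (chunks 11–12 of 12)

Framing: lottery ticket; floor = certified bounds/negative ranges. Venture `PackingBounds` (cell
`pub-packcert`), three-point SDP family. Integer data of a feasible point of the Bachoc–Vallentin
semidefinite program (n = 7, s = 1/2, degree d = 12, symmetric
sums of squares), derived by `pub-packcert-lp/code/lean3pt/cert2lean_lp.py` from the exact rational certificate
`sdp-d7-deg12-sym-lp-v1.json` of the cell (exact verifier #1 + verifier #2 of the other seat), in the units of the kernel
checker `ThreePointCert.Check` (soundness `ThreePointCert.Sound`/`Soundness`); Gram factors offset-encoded for the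
Kronecker-packed chunk validation `ThreePointCert.CheckKron` (emitter `emitleanK.py`, lp gen 3). Generated file: plain
lists of integers / monomials.
-/

namespace Summit.Ventures.PackingBounds.ThreePointCert.K7d12

open Literature.Geometry.DiscreteGeometry Literature.Geometry.DiscreteGeometry.PolyCert PolyCert.SPoly

set_option maxRecDepth 100000 in
set_option maxHeartbeats 0 in
/-- Block `R0`: rows from 410 (27 rows) of `zᵀ(LLᵀ)z` added to `dR0c10` give `dR0c11` (kernel, Kronecker-packed chunk check). -/
theorem okR0_11 : chunkOKK K7d12.gR0K 410 27 K7d12.dR0c10 K7d12.dR0c11 = true := by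
  decide +kernel

set_option maxRecDepth 100000 in
set_option maxHeartbeats 0 in
/-- Block `R0`: rows from 437 ((K7d12.gR0K.z.length - 437) rows) of `zᵀ(LLᵀ)z` added to `dR0c11` give `eR0` (kernel, Kronecker-packed chunk check). -/
theorem okR0_12 : chunkOKK K7d12.gR0K 437 (K7d12.gR0K.z.length - 437) K7d12.dR0c11 K7d12.eR0 = true := by
  decide +kernel

end Summit.Ventures.PackingBounds.ThreePointCert.K7d12
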